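import Summits.Ventures.LatticeQCDFlow.Scoring.GaussVandermondeSecondMoment
import Summits.Ventures.LatticeQCDFlow.Scoring.UNOnePlaquetteCumulants
import HarnessLib

/-!
# The one-loop law of the `U(N)` one-plaquette PLAQUETTE for every `N`: `β (1 − P_N(β)) → N/2` as `β → ∞`

HONEST FRAMING: exact (Metropolis-corrected) sampling algorithms for lattice gauge theory;
figures of merit are autocorrelation/cost numbers at stated couplings and volumes; no
continuum-physics claim.

Venture `LatticeQCDFlow` (cell pub-lqcd), sub-topic `Scoring`; FANOUT row 5 (`s0-sun-a`), GEN-20.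
NEW WORK of the cell (placement rule).  GEN-17's `UNOnePlaquetteCumulants` has `P_N(β) → 1` (`β → ∞`) for the
`U(N)` one-plaquette plaquette `P_N(β) = ⟨N⁻¹ Re tr U⟩_β = N⁻¹ (log det[I_{|i−j|}])′(β)` (which by GEN-19 (24) IS the
plaquette of the infinite-volume two-dimensional `U(N)` theory), and GEN-15 has the `U(1)` rate
`β(1 − I₁(β)/I₀(β)) → ½`.  Here, THE RATE FOR EVERY `N`: Laplace's method (GEN-20 `BesselToeplitzLaplace`) with the
weight `Σ_b x(1 − cos θ_b) → Σ_b φ_b²/2`, and the second moment `∫ Σφ² e^{−Σφ²/2}Δ² = N² M_N`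
(`GaussVandermondeSecondMoment`):

* §1 **`integral_haar_unitaryGroup_sub_trace_mul_exp`** — Weyl's formula for the class function `(N − Re tr U) e^{x Re tr U}`:
  `∫_{U(N)} (N − Re tr U) e^{x Re tr U} dU = ((2π)^N N!)⁻¹ ∫_{(−π,π]^N} (Σ_b (1 − cos θ_b)) e^{xΣcos θ} Π|e^{iθ_j} − e^{iθ_k}|² dθ`;
* §2 the weighted Laplace limit: `integral_weightedScaledIntegrand_eq` (change of variables),
  **`tendsto_integral_weightedScaledIntegrand`** (`→ (N²/2) M_N`);
* §3 **`tendsto_mul_sub_deriv_log_det_besselI_toeplitz`** — `x · (N − (log det[I_{|i−j|}])′(x)) → N²/2` as `x → ∞`,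
  and **`tendsto_mul_one_sub_unitary_plaquette`** — `β (1 − P_N(β)) → N/2` (`N ≥ 1`): the one-loop coefficient
  `dim U(N)/(2N) = N/2` of the 2-d `U(N)` plaquette, exactly.

No `def`, nothing cited as a fact, 0 sorry.
-/

noncomputable section

open Real MeasureTheory Filter Topology Finset
open scoped ENNReal
open Complex (I)
open Literature.MathematicalPhysics.QuantumFieldTheory (haarProbability)
open Literature.Analysis.FunctionSpaces (besselI)
open Literature.RepresentationTheory.CompactGroups
open Literature.RepresentationTheory.CompactGroups.WeylIntegration

namespace Summit.Ventures.LatticeQCDFlow.Scoring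

/-! ### 1. Weyl's formula for `(N − Re tr U) e^{x Re tr U}` -/

/-- The torus integrand `(Σ_b (1 − cos θ_b)) e^{xΣcos θ} Π|e^{iθ_j} − e^{iθ_k}|²` is continuous. -/
theorem continuous_cube_weighted (N : ℕ) (x : ℝ) :
    Continuous (fun θ : Fin N → ℝ => (∑ b, (1 - Real.cos (θ b))) * (Real.exp (x * ∑ b, Real.cos (θ b)) *
        ∏ p : OD (Fin N), ‖Complex.exp (θ p.1.1 * I) - Complex.exp (θ p.1.2 * I)‖ ^ 2)) := by
  refine (continuous_finsetSum _ fun b _ => continuous_const.sub (Real.continuous_cos.comp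
    (continuous_apply b))).mul ((Real.continuous_exp.comp (continuous_const.mul
      (continuous_finsetSum _ fun b _ => Real.continuous_cos.comp (continuous_apply b)))).mul
        (continuous_finsetProd _ fun p _ => ?_))
  exact ((Complex.continuous_exp.comp ((Complex.continuous_ofReal.comp (continuous_apply _)).mul
    continuous_const)).sub (Complex.continuous_exp.comp ((Complex.continuous_ofReal.comp
      (continuous_apply _)).mul continuous_const))).norm.pow 2

/-- The weighted torus integrand is integrable on the cube (it is at most `2N` times the unweighted one). -/
theorem integrable_cube_weighted (N : ℕ) (x : ℝ) :
    Integrable (fun θ : Fin N → ℝ => (∑ b, (1 - Real.cos (θ b))) * (Real.exp (x * ∑ b, Real.cos (θ b)) *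
        ∏ p : OD (Fin N), ‖Complex.exp (θ p.1.1 * I) - Complex.exp (θ p.1.2 * I)‖ ^ 2))
      (Measure.pi fun _ : Fin N => (volume : Measure ℝ).restrict (Set.Ioc (-π) π)) := by
  have h := integrable_cube_exp_mul_sum_cos_mul_prod_norm_sub_sq (n := Fin N) x
  refine (h.const_mul (2 * N)).mono' (continuous_cube_weighted N x).aestronglyMeasurable
    (Eventually.of_forall fun θ => ?_)
  have hF0 : 0 ≤ Real.exp (x * ∑ b, Real.cos (θ b)) *
      ∏ p : OD (Fin N), ‖Complex.exp (θ p.1.1 * I) - Complex.exp (θ p.1.2 * I)‖ ^ 2 :=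
    mul_nonneg (Real.exp_nonneg _) (Finset.prod_nonneg fun p _ => sq_nonneg _)
  have hS0 : 0 ≤ ∑ b : Fin N, (1 - Real.cos (θ b)) := Finset.sum_nonneg fun b _ => by linarith [Real.cos_le_one (θ b)]
  have hS : ∑ b : Fin N, (1 - Real.cos (θ b)) ≤ 2 * N := by
    calc ∑ b : Fin N, (1 - Real.cos (θ b)) ≤ ∑ _b : Fin N, (2 : ℝ) :=
          Finset.sum_le_sum fun b _ => by linarith [Real.neg_one_le_cos (θ b)]
      _ = 2 * N := by simp [mul_comm]
  rw [Real.norm_eq_abs, abs_of_nonneg (mul_nonneg hS0 hF0)]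
  exact mul_le_mul_of_nonneg_right hS hF0

/-- **Weyl's formula for the class function `(N − Re tr U) e^{x Re tr U}`** on `U(N)`:
`∫_{U(N)} (N − Re tr U) e^{x Re tr U} dU = ((2π)^N N!)⁻¹ ∫_{(−π,π]^N} (Σ_b (1 − cos θ_b)) e^{xΣ_b cos θ_b} Π_{j≺k}|e^{iθ_j} − e^{iθ_k}|² dθ`. -/
theorem integral_haar_unitaryGroup_sub_trace_mul_exp (N : ℕ) (x : ℝ) :
    ∫ u, (((N : ℝ) - ((u : Matrix.unitaryGroup (Fin N) ℂ) : Matrix (Fin N) (Fin N) ℂ).trace.re) *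
        Real.exp (x * ((u : Matrix.unitaryGroup (Fin N) ℂ) : Matrix (Fin N) (Fin N) ℂ).trace.re))
        ∂(haarProbability (Matrix.unitaryGroup (Fin N) ℂ))
      = ((2 * π) ^ N * N.factorial)⁻¹ *
        ∫ θ, (∑ b, (1 - Real.cos (θ b))) * (Real.exp (x * ∑ b, Real.cos (θ b)) *
            ∏ p : OD (Fin N), ‖Complex.exp (θ p.1.1 * I) - Complex.exp (θ p.1.2 * I)‖ ^ 2)
          ∂(Measure.pi fun _ : Fin N => (volume : Measure ℝ).restrict (Set.Ioc (-π) π)) := by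
  -- continuity, sign and class invariance of `u ↦ (N − Re tr u) e^{x Re tr u}`
  have htr : Continuous fun u : Matrix.unitaryGroup (Fin N) ℂ =>
      ((u : Matrix.unitaryGroup (Fin N) ℂ) : Matrix (Fin N) (Fin N) ℂ).trace.re :=
    Complex.continuous_re.comp (continuous_id.matrix_trace.comp continuous_subtype_val)
  have hGc : Continuous fun u : Matrix.unitaryGroup (Fin N) ℂ =>
      (((N : ℝ) - ((u : Matrix.unitaryGroup (Fin N) ℂ) : Matrix (Fin N) (Fin N) ℂ).trace.re) *
        Real.exp (x * ((u : Matrix.unitaryGroup (Fin N) ℂ) : Matrix (Fin N) (Fin N) ℂ).trace.re)) :=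
    (continuous_const.sub htr).mul (Real.continuous_exp.comp (continuous_const.mul htr))
  have hG0 : ∀ u : Matrix.unitaryGroup (Fin N) ℂ, 0 ≤ (((N : ℝ) - ((u : Matrix.unitaryGroup (Fin N) ℂ) :
      Matrix (Fin N) (Fin N) ℂ).trace.re) * Real.exp (x * ((u : Matrix.unitaryGroup (Fin N) ℂ) :
        Matrix (Fin N) (Fin N) ℂ).trace.re)) := fun u => by
    have h := abs_trace_re_le_card u
    rw [Fintype.card_fin] at h
    exact mul_nonneg (by linarith [(abs_le.1 h).2]) (Real.exp_nonneg _)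
  have hF : Measurable fun u : Matrix.unitaryGroup (Fin N) ℂ => ENNReal.ofReal
      ((((N : ℝ) - ((u : Matrix.unitaryGroup (Fin N) ℂ) : Matrix (Fin N) (Fin N) ℂ).trace.re) *
        Real.exp (x * ((u : Matrix.unitaryGroup (Fin N) ℂ) : Matrix (Fin N) (Fin N) ℂ).trace.re))) :=
    ENNReal.measurable_ofReal.comp hGc.measurable
  have hcl : ∀ g u : Matrix.unitaryGroup (Fin N) ℂ, ENNReal.ofReal
      ((((N : ℝ) - (((g * u * g⁻¹ : Matrix.unitaryGroup (Fin N) ℂ)) : Matrix (Fin N) (Fin N) ℂ).trace.re) *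
        Real.exp (x * (((g * u * g⁻¹ : Matrix.unitaryGroup (Fin N) ℂ)) : Matrix (Fin N) (Fin N) ℂ).trace.re)))
      = ENNReal.ofReal ((((N : ℝ) - ((u : Matrix.unitaryGroup (Fin N) ℂ) : Matrix (Fin N) (Fin N) ℂ).trace.re) *
        Real.exp (x * ((u : Matrix.unitaryGroup (Fin N) ℂ) : Matrix (Fin N) (Fin N) ℂ).trace.re))) := by
    intro g u
    rw [trace_conj_unitaryGroup]
  -- Weyl's formula in `ℝ≥0∞` form
  have hW := lintegral_unitaryGroup_eq_angleIntegral hF hcl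
  rw [angleIntegral] at hW
  simp_rw [trace_re_torusPt] at hW
  rw [show (volume : Measure (Fin N → ℝ)).restrict (Set.pi Set.univ fun _ => Set.Ioc (-π) π) =
    Measure.pi fun _ : Fin N => (volume : Measure ℝ).restrict (Set.Ioc (-π) π) from Measure.restrict_pi_pi _ _] at hW
  -- the torus integrand, `ℝ≥0∞` product merged
  have hsum : ∀ θ : Fin N → ℝ, ((N : ℝ) - ∑ b, Real.cos (θ b)) = ∑ b, (1 - Real.cos (θ b)) := by
    intro θ
    rw [Finset.sum_sub_distrib, Finset.sum_const, Finset.card_univ, Fintype.card_fin, nsmul_eq_mul, mul_one]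
  have hprod : ∀ θ : Fin N → ℝ,
      ENNReal.ofReal (((N : ℝ) - ∑ b, Real.cos (θ b)) * Real.exp (x * ∑ b, Real.cos (θ b))) *
        ENNReal.ofReal (∏ p : OD (Fin N), ‖Complex.exp (θ p.1.1 * I) - Complex.exp (θ p.1.2 * I)‖ ^ 2)
      = ENNReal.ofReal ((∑ b, (1 - Real.cos (θ b))) * (Real.exp (x * ∑ b, Real.cos (θ b)) *
          ∏ p : OD (Fin N), ‖Complex.exp (θ p.1.1 * I) - Complex.exp (θ p.1.2 * I)‖ ^ 2)) := by
    intro θ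
    have hS0 : 0 ≤ ∑ b : Fin N, (1 - Real.cos (θ b)) := Finset.sum_nonneg fun b _ => by linarith [Real.cos_le_one (θ b)]
    rw [hsum, ← ENNReal.ofReal_mul (mul_nonneg hS0 (Real.exp_nonneg _)), mul_assoc]
  simp_rw [hprod] at hW
  have hnn : ∀ θ : Fin N → ℝ, 0 ≤ (∑ b, (1 - Real.cos (θ b))) * (Real.exp (x * ∑ b, Real.cos (θ b)) *
      ∏ p : OD (Fin N), ‖Complex.exp (θ p.1.1 * I) - Complex.exp (θ p.1.2 * I)‖ ^ 2) := fun θ =>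
    mul_nonneg (Finset.sum_nonneg fun b _ => by linarith [Real.cos_le_one (θ b)])
      (mul_nonneg (Real.exp_nonneg _) (Finset.prod_nonneg fun p _ => sq_nonneg _))
  rw [← ofReal_integral_eq_lintegral_ofReal (integrable_cube_weighted N x) (Eventually.of_forall hnn)] at hW
  -- back to real integrals
  rw [integral_eq_lintegral_of_nonneg_ae (Eventually.of_forall hG0) hGc.aestronglyMeasurable, hW]
  simp only [Fintype.card_fin, ENNReal.toReal_mul, ENNReal.toReal_inv, ENNReal.toReal_pow,
    ENNReal.toReal_ofReal Real.two_pi_pos.le, ENNReal.toReal_natCast, ENNReal.toReal_ofReal (integral_nonneg hnn)]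

/-! ### 2. The weighted Laplace limit -/

/-- The weight: `0 ≤ Σ_b x(1 − cos(φ_b/√x)) ≤ Σ_b φ_b²/2` for `x > 0`. -/
theorem laplaceWeight_mem_Icc {N : ℕ} {x : ℝ} (hx : 0 < x) (φ : Fin N → ℝ) :
    0 ≤ ∑ b, x * (1 - Real.cos (φ b / √x)) ∧ ∑ b, x * (1 - Real.cos (φ b / √x)) ≤ (∑ b, φ b ^ 2) / 2 := by
  constructor
  · exact Finset.sum_nonneg fun b _ => mul_nonneg hx.le (by linarith [Real.cos_le_one (φ b / √x)])
  · rw [Finset.sum_div]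
    refine Finset.sum_le_sum fun b _ => ?_
    have h := neg_sq_div_two_le_mul_cos_div_sqrt_sub_one hx (φ b)
    linarith

/-- The weight tends to `Σ_b φ_b²/2`. -/
theorem tendsto_laplaceWeight {N : ℕ} (φ : Fin N → ℝ) :
    Tendsto (fun x : ℝ => ∑ b, x * (1 - Real.cos (φ b / √x))) atTop (𝓝 ((∑ b, φ b ^ 2) / 2)) := by
  rw [Finset.sum_div]
  refine tendsto_finsetSum _ fun b _ => ?_
  have h := (tendsto_mul_cos_div_sqrt_sub_one (φ b)).neg
  refine (h.congr fun x => by ring).trans ?_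
  rw [neg_neg]

/-- **Change of variables for the weighted integrand** (`x > 0`):
`∫_{ℝ^N} 1[φ/√x ∈ cube] (Σ_b x(1−cos(φ_b/√x))) e^{Σ x(cos(φ_b/√x)−1)} Π 2x(1−cos((φ_j−φ_k)/√x)) dφ
 = e^{−Nx} x^{|OD|} √x^{N} · ∫_{cube} (Σ_b x(1 − cos θ_b)) e^{xΣcosθ} Π|e^{iθ_j}−e^{iθ_k}|² dθ`. -/
theorem integral_weightedScaledIntegrand_eq {N : ℕ} {x : ℝ} (hx : 0 < x) :
    ∫ φ : Fin N → ℝ, (∑ b, x * (1 - Real.cos (φ b / √x))) *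
        ((fun φ : Fin N → ℝ => fun b => φ b / √x) ⁻¹' Set.univ.pi fun _ => Set.Ioc (-π) π).indicator
          (fun φ => Real.exp (∑ b, x * (Real.cos (φ b / √x) - 1)) *
            ∏ p : OD (Fin N), (2 * x * (1 - Real.cos ((φ p.1.1 - φ p.1.2) / √x)))) φ
      = Real.exp (-(N * x)) * x ^ Fintype.card (OD (Fin N)) * √x ^ N *
        ∫ θ, (∑ b, x * (1 - Real.cos (θ b))) * (Real.exp (x * ∑ b, Real.cos (θ b)) *
            ∏ p : OD (Fin N), ‖Complex.exp (θ p.1.1 * I) - Complex.exp (θ p.1.2 * I)‖ ^ 2)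
          ∂(Measure.pi fun _ : Fin N => (volume : Measure ℝ).restrict (Set.Ioc (-π) π)) := by
  have hsx : 0 < √x := Real.sqrt_pos.2 hx
  set c : ℝ := (√x)⁻¹ with hc
  set F : (Fin N → ℝ) → ℝ := fun θ => (∑ b, x * (1 - Real.cos (θ b))) * (Real.exp (x * ∑ b, Real.cos (θ b)) *
    ∏ p : OD (Fin N), (2 - 2 * Real.cos (θ p.1.1 - θ p.1.2))) with hF
  set cube : Set (Fin N → ℝ) := Set.univ.pi fun _ => Set.Ioc (-π) π with hcube
  have hcube_meas : MeasurableSet cube := MeasurableSet.univ_pi fun _ => measurableSet_Ioc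
  have htorus : ∫ θ, (∑ b, x * (1 - Real.cos (θ b))) * (Real.exp (x * ∑ b, Real.cos (θ b)) *
        ∏ p : OD (Fin N), ‖Complex.exp (θ p.1.1 * I) - Complex.exp (θ p.1.2 * I)‖ ^ 2)
        ∂(Measure.pi fun _ : Fin N => (volume : Measure ℝ).restrict (Set.Ioc (-π) π))
      = ∫ θ : Fin N → ℝ, cube.indicator F θ := by
    simp_rw [norm_cexp_sub_cexp_sq]
    rw [← Measure.restrict_pi_pi, ← volume_pi, integral_indicator hcube_meas]
  have hscale : ∀ φ : Fin N → ℝ, (fun b => φ b / √x) = c • φ := by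
    intro φ; funext b; simp [hc, div_eq_inv_mul]
  have hind : ∀ φ : Fin N → ℝ, (∑ b, x * (1 - Real.cos (φ b / √x))) *
      ((fun φ : Fin N → ℝ => fun b => φ b / √x) ⁻¹' cube).indicator
        (fun φ => Real.exp (∑ b, x * (Real.cos (φ b / √x) - 1)) *
          ∏ p : OD (Fin N), (2 * x * (1 - Real.cos ((φ p.1.1 - φ p.1.2) / √x)))) φ
      = Real.exp (-(N * x)) * x ^ Fintype.card (OD (Fin N)) * (cube.indicator F) (c • φ) := by
    intro φ
    by_cases hφ : (fun b => φ b / √x) ∈ cube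
    · rw [Set.indicator_of_mem (show φ ∈ (fun φ : Fin N → ℝ => fun b => φ b / √x) ⁻¹' cube from hφ),
        Set.indicator_of_mem (show c • φ ∈ cube by rwa [← hscale]), scaledIntegrand_eq_mul, hF, ← hscale]
      simp only [Fintype.card_fin]
      ring
    · rw [Set.indicator_of_notMem (show φ ∉ (fun φ : Fin N → ℝ => fun b => φ b / √x) ⁻¹' cube from hφ),
        Set.indicator_of_notMem (show c • φ ∉ cube by rwa [← hscale]), mul_zero, mul_zero]
  simp_rw [hind]
  rw [integral_const_mul, Measure.integral_comp_smul volume (cube.indicator F) c, htorus,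
    Module.finrank_fintype_fun_eq_card, smul_eq_mul]
  have hcN : |(c ^ Fintype.card (Fin N))⁻¹| = √x ^ N := by
    rw [Fintype.card_fin, hc, inv_pow, inv_inv, abs_of_pos (pow_pos hsx _)]
  rw [hcN]
  ring

/-- **The weighted Laplace limit**: `∫ (weight) × (scaled integrand) → ∫ (Σφ²/2) e^{−Σφ²/2} Δ² = (N²/2) M_N`. -/
theorem tendsto_integral_weightedScaledIntegrand (N : ℕ) :
    Tendsto (fun x : ℝ => ∫ φ : Fin N → ℝ, (∑ b, x * (1 - Real.cos (φ b / √x))) *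
        ((fun φ : Fin N → ℝ => fun b => φ b / √x) ⁻¹' Set.univ.pi fun _ => Set.Ioc (-π) π).indicator
          (fun φ => Real.exp (∑ b, x * (Real.cos (φ b / √x) - 1)) *
            ∏ p : OD (Fin N), (2 * x * (1 - Real.cos ((φ p.1.1 - φ p.1.2) / √x)))) φ)
      atTop (𝓝 ((N : ℝ) ^ 2 / 2 *
        ∫ φ : Fin N → ℝ, Real.exp (∑ b, -(φ b ^ 2 / 2)) * ∏ p : OD (Fin N), (φ p.1.1 - φ p.1.2) ^ 2)) := by
  have hlim : (N : ℝ) ^ 2 / 2 *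
      ∫ φ : Fin N → ℝ, Real.exp (∑ b, -(φ b ^ 2 / 2)) * ∏ p : OD (Fin N), (φ p.1.1 - φ p.1.2) ^ 2
      = ∫ φ : Fin N → ℝ, (∑ b, φ b ^ 2) / 2 *
          (Real.exp (∑ b, -(φ b ^ 2 / 2)) * ∏ p : OD (Fin N), (φ p.1.1 - φ p.1.2) ^ 2) := by
    have h := integral_normSq_gaussVandermonde (n := Fin N)
    simp only [Fintype.card_fin] at h
    have e : (fun φ : Fin N → ℝ => (∑ b, φ b ^ 2) / 2 *
        (Real.exp (∑ b, -(φ b ^ 2 / 2)) * ∏ p : OD (Fin N), (φ p.1.1 - φ p.1.2) ^ 2))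
        = fun φ => (1 / 2) * ((∑ b, φ b ^ 2) *
          (Real.exp (∑ b, -(φ b ^ 2 / 2)) * ∏ p : OD (Fin N), (φ p.1.1 - φ p.1.2) ^ 2)) := by
      funext φ; ring
    rw [e, integral_const_mul, h]
    ring
  rw [hlim]
  refine tendsto_integral_filter_of_dominated_convergence
    (fun φ => 2 ^ Fintype.card (OD (Fin N)) * ∏ b, (Real.exp (-(2 / π ^ 2 * φ b ^ 2)) *
      (1 + φ b ^ 2) ^ (Fintype.card (OD (Fin N)) + 1))) ?_ ?_ (integrable_gaussPolyBound _ _)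
    (Eventually.of_forall fun φ => (tendsto_laplaceWeight φ).mul (tendsto_scaledIntegrand φ))
  · filter_upwards [eventually_gt_atTop (0 : ℝ)] with x hx
    refine (Continuous.aestronglyMeasurable (by fun_prop)).mul (AEStronglyMeasurable.indicator ?_ ?_)
    · exact (by fun_prop : Continuous fun φ : Fin N → ℝ => Real.exp (∑ b, x * (Real.cos (φ b / √x) - 1)) *
        ∏ p : OD (Fin N), (2 * x * (1 - Real.cos ((φ p.1.1 - φ p.1.2) / √x)))).aestronglyMeasurable
    · exact (MeasurableSet.univ_pi fun _ => measurableSet_Ioc).preimage (by fun_prop)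
  · filter_upwards [eventually_gt_atTop (0 : ℝ)] with x hx
    refine Eventually.of_forall fun φ => ?_
    have hw := laplaceWeight_mem_Icc hx φ
    rw [norm_mul, Real.norm_eq_abs, abs_of_nonneg hw.1, Real.norm_eq_abs]
    by_cases hφ : φ ∈ (fun φ : Fin N → ℝ => fun b => φ b / √x) ⁻¹' Set.univ.pi fun _ => Set.Ioc (-π) π
    · rw [Set.indicator_of_mem hφ, abs_of_nonneg (mul_nonneg (Real.exp_nonneg _)
        (Finset.prod_nonneg fun p _ => pairFactor_nonneg hx.le _))]
      have hb := scaledIntegrand_le_bound hx fun b => hφ b (Set.mem_univ _)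
      have hsum : (∑ b, φ b ^ 2) / 2 ≤ ∏ b, (1 + φ b ^ 2) := by
        have := sum_sq_le_prod_one_add_sq φ
        have h0 : 0 ≤ ∑ b, φ b ^ 2 := Finset.sum_nonneg fun b _ => sq_nonneg _
        linarith
      calc (∑ b, x * (1 - Real.cos (φ b / √x))) * (Real.exp (∑ b, x * (Real.cos (φ b / √x) - 1)) *
            ∏ p : OD (Fin N), (2 * x * (1 - Real.cos ((φ p.1.1 - φ p.1.2) / √x))))
          ≤ (∏ b, (1 + φ b ^ 2)) * (2 ^ Fintype.card (OD (Fin N)) *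
            ∏ b, (Real.exp (-(2 / π ^ 2 * φ b ^ 2)) * (1 + φ b ^ 2) ^ Fintype.card (OD (Fin N)))) :=
            mul_le_mul (hw.2.trans hsum) hb (mul_nonneg (Real.exp_nonneg _)
              (Finset.prod_nonneg fun p _ => pairFactor_nonneg hx.le _)) (Finset.prod_nonneg fun b _ => by positivity)
        _ = 2 ^ Fintype.card (OD (Fin N)) * ∏ b, (Real.exp (-(2 / π ^ 2 * φ b ^ 2)) *
            (1 + φ b ^ 2) ^ (Fintype.card (OD (Fin N)) + 1)) := by
            rw [mul_left_comm, ← Finset.prod_mul_distrib]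
            congr 1
            exact Finset.prod_congr rfl fun b _ => by ring
    · rw [Set.indicator_of_notMem hφ, abs_zero, mul_zero]
      exact mul_nonneg (by positivity) (Finset.prod_nonneg fun b _ => by positivity)

/-! ### 3. The one-loop law of the plaquette -/

/-- **`x · (N − (log det[I_{|i−j|}])′(x)) → N²/2`** as `x → ∞`, every `N`. -/
theorem tendsto_mul_sub_deriv_log_det_besselI_toeplitz (N : ℕ) :
    Tendsto (fun x : ℝ => x * ((N : ℝ) -
        deriv (fun y : ℝ => Real.log (Matrix.of fun i j : Fin N => besselI ((i : ℤ) - (j : ℤ)).natAbs y).det) x))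
      atTop (𝓝 ((N : ℝ) ^ 2 / 2)) := by
  set M : ℝ := ∫ φ : Fin N → ℝ, Real.exp (∑ b, -(φ b ^ 2 / 2)) * ∏ p : OD (Fin N), (φ p.1.1 - φ p.1.2) ^ 2 with hM
  have hMpos : 0 < M := gaussVandermonde_pos (n := Fin N)
  have hK : (0 : ℝ) < (2 * π) ^ N * N.factorial := by positivity
  -- numerator and denominator, both normalised by `e^{−Nx} √x^{N²}`
  have hden := tendsto_det_besselI_toeplitz_weakCoupling N
  have hnum : Tendsto (fun x : ℝ => x * (∫ u, (((N : ℝ) - ((u : Matrix.unitaryGroup (Fin N) ℂ) :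
      Matrix (Fin N) (Fin N) ℂ).trace.re) * Real.exp (x * ((u : Matrix.unitaryGroup (Fin N) ℂ) :
        Matrix (Fin N) (Fin N) ℂ).trace.re)) ∂(haarProbability (Matrix.unitaryGroup (Fin N) ℂ))) *
      Real.exp (-(N * x)) * √x ^ (N ^ 2)) atTop (𝓝 ((N : ℝ) ^ 2 / 2 * M / ((2 * π) ^ N * N.factorial))) := by
    have h := (tendsto_integral_weightedScaledIntegrand N).div_const ((2 * π) ^ N * N.factorial)
    refine h.congr' ?_
    filter_upwards [eventually_gt_atTop (0 : ℝ)] with x hx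
    have hpow : √x ^ (N ^ 2) = x ^ Fintype.card (OD (Fin N)) * √x ^ N := by
      have hc := card_add_two_mul_card_OD (n := Fin N)
      simp only [Fintype.card_fin] at hc
      rw [← hc, pow_add, pow_mul, Real.sq_sqrt hx.le, mul_comm]
    have hI : ∫ θ, (∑ b, x * (1 - Real.cos (θ b))) * (Real.exp (x * ∑ b, Real.cos (θ b)) *
        ∏ p : OD (Fin N), ‖Complex.exp (θ p.1.1 * I) - Complex.exp (θ p.1.2 * I)‖ ^ 2)
        ∂(Measure.pi fun _ : Fin N => (volume : Measure ℝ).restrict (Set.Ioc (-π) π))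
        = x * ∫ θ, (∑ b, (1 - Real.cos (θ b))) * (Real.exp (x * ∑ b, Real.cos (θ b)) *
          ∏ p : OD (Fin N), ‖Complex.exp (θ p.1.1 * I) - Complex.exp (θ p.1.2 * I)‖ ^ 2)
          ∂(Measure.pi fun _ : Fin N => (volume : Measure ℝ).restrict (Set.Ioc (-π) π)) := by
      rw [← integral_const_mul]
      refine integral_congr_ae (Eventually.of_forall fun θ => ?_)
      dsimp only
      generalize (Real.exp (x * ∑ b, Real.cos (θ b)) *
        ∏ p : OD (Fin N), ‖Complex.exp (θ p.1.1 * I) - Complex.exp (θ p.1.2 * I)‖ ^ 2) = R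
      rw [← Finset.mul_sum]
      ring
    rw [integral_weightedScaledIntegrand_eq (N := N) hx]
    rw [hI]
    rw [integral_haar_unitaryGroup_sub_trace_mul_exp]
    rw [hpow]
    set J : ℝ := ∫ θ, (∑ b, (1 - Real.cos (θ b))) * (Real.exp (x * ∑ b, Real.cos (θ b)) *
        ∏ p : OD (Fin N), ‖Complex.exp (θ p.1.1 * I) - Complex.exp (θ p.1.2 * I)‖ ^ 2)
        ∂(Measure.pi fun _ : Fin N => (volume : Measure ℝ).restrict (Set.Ioc (-π) π)) with hJ
    field_simp
  -- the quotient
  have hne : M / ((2 * π) ^ N * N.factorial) ≠ 0 := (div_pos hMpos hK).ne'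
  have hq := hnum.div hden hne
  have hval : (N : ℝ) ^ 2 / 2 * M / ((2 * π) ^ N * N.factorial) / (M / ((2 * π) ^ N * N.factorial)) = (N : ℝ) ^ 2 / 2 := by
    field_simp
  rw [hval] at hq
  refine hq.congr' ?_
  filter_upwards [eventually_gt_atTop (0 : ℝ)] with x hx
  simp only [Pi.div_apply]
  have hD := det_besselI_toeplitz_fin_pos N x
  have hsx : 0 < √x := Real.sqrt_pos.2 hx
  have hderiv := hasDerivAt_det_besselI_toeplitz N x
  rw [(hderiv.log hD.ne').deriv]
  -- `x ∫(N − Re tr)e^{..} · E / (det · E) = x (N − det'/det)`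
  have htr := aestronglyMeasurable_trace_re_unitaryGroup N
  have hbd : ∀ u : Matrix.unitaryGroup (Fin N) ℂ,
      |((u : Matrix.unitaryGroup (Fin N) ℂ) : Matrix (Fin N) (Fin N) ℂ).trace.re| ≤ N := fun u => by
    have h := abs_trace_re_le_card u
    rwa [Fintype.card_fin] at h
  have hexp_le : ∀ u : Matrix.unitaryGroup (Fin N) ℂ,
      Real.exp (x * ((u : Matrix.unitaryGroup (Fin N) ℂ) : Matrix (Fin N) (Fin N) ℂ).trace.re) ≤ Real.exp (|x| * N) := by
    intro u
    refine Real.exp_le_exp.2 ?_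
    calc x * ((u : Matrix.unitaryGroup (Fin N) ℂ) : Matrix (Fin N) (Fin N) ℂ).trace.re
        ≤ |x * ((u : Matrix.unitaryGroup (Fin N) ℂ) : Matrix (Fin N) (Fin N) ℂ).trace.re| := le_abs_self _
      _ = |x| * |((u : Matrix.unitaryGroup (Fin N) ℂ) : Matrix (Fin N) (Fin N) ℂ).trace.re| := abs_mul _ _
      _ ≤ |x| * N := mul_le_mul_of_nonneg_left (hbd u) (abs_nonneg _)
  have hce : Continuous fun u : Matrix.unitaryGroup (Fin N) ℂ =>
      Real.exp (x * ((u : Matrix.unitaryGroup (Fin N) ℂ) : Matrix (Fin N) (Fin N) ℂ).trace.re) :=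
    Real.continuous_exp.comp (continuous_const.mul (Complex.continuous_re.comp
      (continuous_id.matrix_trace.comp continuous_subtype_val)))
  have hctr : Continuous fun u : Matrix.unitaryGroup (Fin N) ℂ =>
      ((u : Matrix.unitaryGroup (Fin N) ℂ) : Matrix (Fin N) (Fin N) ℂ).trace.re :=
    Complex.continuous_re.comp (continuous_id.matrix_trace.comp continuous_subtype_val)
  have hint1 : Integrable (fun u : Matrix.unitaryGroup (Fin N) ℂ => (N : ℝ) *
      Real.exp (x * ((u : Matrix.unitaryGroup (Fin N) ℂ) : Matrix (Fin N) (Fin N) ℂ).trace.re))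
      (haarProbability (Matrix.unitaryGroup (Fin N) ℂ)) := by
    refine Integrable.mono' (integrable_const ((N : ℝ) * Real.exp (|x| * N))) (continuous_const.mul hce).aestronglyMeasurable
      (Eventually.of_forall fun u => ?_)
    rw [Real.norm_eq_abs, abs_of_nonneg (by positivity)]
    exact mul_le_mul_of_nonneg_left (hexp_le u) (Nat.cast_nonneg N)
  have hint2 : Integrable (fun u : Matrix.unitaryGroup (Fin N) ℂ =>
      ((u : Matrix.unitaryGroup (Fin N) ℂ) : Matrix (Fin N) (Fin N) ℂ).trace.re *
        Real.exp (x * ((u : Matrix.unitaryGroup (Fin N) ℂ) : Matrix (Fin N) (Fin N) ℂ).trace.re))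
      (haarProbability (Matrix.unitaryGroup (Fin N) ℂ)) := by
    refine Integrable.mono' (integrable_const ((N : ℝ) * Real.exp (|x| * N))) (hctr.mul hce).aestronglyMeasurable
      (Eventually.of_forall fun u => ?_)
    rw [Real.norm_eq_abs, abs_mul, abs_of_nonneg (Real.exp_nonneg _)]
    exact mul_le_mul (hbd u) (hexp_le u) (Real.exp_nonneg _) (Nat.cast_nonneg N)
  have hsplit : ∫ u, (((N : ℝ) - ((u : Matrix.unitaryGroup (Fin N) ℂ) : Matrix (Fin N) (Fin N) ℂ).trace.re) *
      Real.exp (x * ((u : Matrix.unitaryGroup (Fin N) ℂ) : Matrix (Fin N) (Fin N) ℂ).trace.re))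
        ∂(haarProbability (Matrix.unitaryGroup (Fin N) ℂ))
      = N * (Matrix.of fun i j : Fin N => besselI ((i : ℤ) - (j : ℤ)).natAbs x).det -
        ∫ u, ((u : Matrix.unitaryGroup (Fin N) ℂ) : Matrix (Fin N) (Fin N) ℂ).trace.re *
          Real.exp (x * ((u : Matrix.unitaryGroup (Fin N) ℂ) : Matrix (Fin N) (Fin N) ℂ).trace.re)
          ∂(haarProbability (Matrix.unitaryGroup (Fin N) ℂ)) := by
    rw [← integral_haar_unitaryGroup_fin_exp_mul_trace_re, ← integral_const_mul, ← integral_sub hint1 hint2]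
    refine integral_congr_ae (Eventually.of_forall fun u => ?_)
    ring
  rw [hsplit]
  have hE : Real.exp (-(N * x)) * √x ^ (N ^ 2) ≠ 0 := by positivity
  field_simp

/-- **THE ONE-LOOP LAW OF THE `U(N)` PLAQUETTE, EVERY `N ≥ 1`**: with
`P_N(β) = ∫ N⁻¹ Re tr U e^{−β(N − Re tr U)} dU / ∫ e^{−β(N − Re tr U)} dU` the one-plaquette (and, in two dimensions,
infinite-volume) `U(N)` plaquette, `β · (1 − P_N(β)) → N/2` as `β → ∞` — the leading perturbative coefficient
`dim U(N)/(2N)`, exactly. -/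
theorem tendsto_mul_one_sub_unitary_plaquette (N : ℕ) [NeZero N] :
    Tendsto (fun β : ℝ => β * (1 -
      (∫ u, ((u : Matrix.unitaryGroup (Fin N) ℂ) : Matrix (Fin N) (Fin N) ℂ).trace.re / N *
          Real.exp (-(β * ((N : ℝ) - ((u : Matrix.unitaryGroup (Fin N) ℂ) : Matrix (Fin N) (Fin N) ℂ).trace.re)))
        ∂(haarProbability (Matrix.unitaryGroup (Fin N) ℂ)))
      / (∫ u, Real.exp (-(β * ((N : ℝ) - ((u : Matrix.unitaryGroup (Fin N) ℂ) : Matrix (Fin N) (Fin N) ℂ).trace.re)))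
        ∂(haarProbability (Matrix.unitaryGroup (Fin N) ℂ))))) atTop (𝓝 ((N : ℝ) / 2)) := by
  simp_rw [unitary_plaquette_eq_deriv_log_det]
  have hN : (N : ℝ) ≠ 0 := Nat.cast_ne_zero.2 (NeZero.ne N)
  have h := (tendsto_mul_sub_deriv_log_det_besselI_toeplitz N).const_mul (1 / (N : ℝ))
  rw [show 1 / (N : ℝ) * ((N : ℝ) ^ 2 / 2) = (N : ℝ) / 2 by field_simp] at h
  refine h.congr fun β => ?_
  field_simp

end Summit.Ventures.LatticeQCDFlow.Scoring
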